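import Summits.ResolutionOfSingularities.ResolutionOfSingularities.Theorems.FrobeniusLadderFInjectiveMacaulayficationCoordinateSlicing
import Mathlib.Algebra.MvPolynomial.Expand
import Mathlib.Algebra.MvPolynomial.Degrees
import Mathlib.RingTheory.MvPolynomial.Ideal
import Mathlib.RingTheory.MvPolynomial.Basic
import Mathlib.Algebra.CharP.Lemmas
import Mathlib.Algebra.CharP.Algebra
import Mathlib.Data.Finsupp.Fintype
import HarnessLib

/-!
# (C5) TORUS FEDDER CERTIFICATE ⇒ F-PURE FACE: one Bézout identity certifies Fedder's test at every torus point
# (crux `FInjectiveMacaulayfication`, CN engine in global form — `L/w45a/CNEngineSig.lean` c51053d0 §4 `stub_faceFPure_of_certificate`,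
# statement VERBATIM)

Support file for crux stmt-ResolutionOfSingularities-15315 (`FrobeniusLadder.FInjectiveMacaulayfication`), chain w45a,
seat res-L1-w45a-stub-3 (first idle typer, CRUX-PLAN v6 §1.3 (C5)). [OURS · L1 W4.5a] — NOT a statement of the manuscript;
AI-written, weaker than expert review.

For a face polynomial `F ∈ k[y]` with `F^(p-1) = Σ_α ψ_p(c_α) · y^α` over the reduced exponents `α ∈ [0,p)^n` (`ψ_p = expand p`),
ONE Bézout identity `1 ∈ (F, ψ_p(c_α) ∀ α, 1 − t·∏ yⱼ)` in `k[y, t]` gives Fedder's test `(F ⊗ K)^(p-1) ∉ ((yᵢ − bᵢ)^p)` at every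
point `b` of the torus over every field `K ⊇ k` with `F(b) = 0`. The proof does NOT use freeness of `K[y]` over `K[y^p]`:

* evaluating the identity at `(b, (∏ b)⁻¹)` shows some `ψ_p(c_α)` does not vanish at `b`, i.e. `c_α(b^p) ≠ 0` (`exists_aeval_expand_ne_zero`);
* if the test failed, shift `τ : yᵢ ↦ yᵢ + bᵢ`: `τ(F^(p-1)) ∈ (yᵢ^p)`, a MONOMIAL ideal, so all reduced coefficients vanish
  (`coeff_eq_zero_of_mem_span_X_pow`, `eq_zero_of_mem_of_degreeOf_lt`); `τ ∘ ψ_p = ψ_p ∘ τ′` with `τ′ : yᵢ ↦ yᵢ + bᵢ^p` (Frobenius,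
  `aeval_shift_expand`) and `ψ_p(r) ≡ C(r(0)) (mod (yᵢ^p))` (`expand_sub_C_mem_span_X_pow`), whence
  `Σ_α c_α(b^p) · ∏ⱼ (yⱼ + bⱼ)^(αⱼ) ∈ (yᵢ^p)` with all `yᵢ`-degrees `< p`, so it is `0`; shifting back, `Σ_α c_α(b^p) y^α = 0`, so every
  `c_α(b^p) = 0` (`eq_zero_of_sum_C_mul_monomial_eq_zero`) — contradiction.

* `faceFPure_of_certificate` — **(C5)**, the registered text verbatim.

No definitions, no named facts; glue on Mathlib (+ `CoordinateSlicing.sub_C_constantCoeff_mem_span_X`). [folklore]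
-/

-- single-problem summit: the doubled namespace component is forced
set_option linter.dupNamespace false

noncomputable section

namespace Summit.ResolutionOfSingularities.ResolutionOfSingularities.Theorems.FInjectiveMacaulayfication.FaceFPureOfCertificate

open Summit.ResolutionOfSingularities.ResolutionOfSingularities.Theorems.FInjectiveMacaulayfication

variable {K : Type} [CommRing K] {n : ℕ}

/-! ## The monomial ideal `(y₁^p, …, yₙ^p)` -/

/-- `(yᵢ^p : i)` as a monomial ideal. [folklore] -/
theorem span_X_pow_eq (p : ℕ) :
    Ideal.span (Set.range fun i : Fin n => (MvPolynomial.X i : MvPolynomial (Fin n) K) ^ p) =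
      Ideal.span ((fun s : Fin n →₀ ℕ => MvPolynomial.monomial s (1 : K)) ''
        Set.range fun i : Fin n => Finsupp.single i p) := by
  rw [← Set.range_comp]
  refine congrArg _ (congrArg _ (funext fun i => ?_))
  simp only [Function.comp_apply, MvPolynomial.X_pow_eq_monomial]

/-- **Reduced coefficients of an element of `(yᵢ^p)` vanish.** [folklore] -/
theorem coeff_eq_zero_of_mem_span_X_pow (p : ℕ) {x : MvPolynomial (Fin n) K}
    (hx : x ∈ Ideal.span (Set.range fun i : Fin n => (MvPolynomial.X i : MvPolynomial (Fin n) K) ^ p))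
    (m : Fin n →₀ ℕ) (hm : ∀ i, m i < p) : MvPolynomial.coeff m x = 0 := by
  rw [span_X_pow_eq, MvPolynomial.mem_ideal_span_monomial_image] at hx
  by_contra h
  obtain ⟨_, ⟨i, rfl⟩, hle⟩ := hx m (MvPolynomial.mem_support_iff.mpr h)
  have h1 := hle i
  rw [Finsupp.single_eq_same] at h1
  exact absurd (hm i) (not_lt.mpr h1)

/-- **An element of `(yᵢ^p)` all of whose `yᵢ`-degrees are `< p` is zero.** [folklore] -/
theorem eq_zero_of_mem_of_degreeOf_lt (p : ℕ) (hp : 0 < p) {x : MvPolynomial (Fin n) K}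
    (hx : x ∈ Ideal.span (Set.range fun i : Fin n => (MvPolynomial.X i : MvPolynomial (Fin n) K) ^ p))
    (hdeg : ∀ i, MvPolynomial.degreeOf i x < p) : x = 0 := by
  ext m
  rw [MvPolynomial.coeff_zero]
  by_cases hms : m ∈ x.support
  · exact coeff_eq_zero_of_mem_span_X_pow p hx m fun i => (MvPolynomial.degreeOf_lt_iff hp).mp (hdeg i) m hms
  · exact MvPolynomial.notMem_support_iff.mp hms

/-- **`ψ_p(r) ≡ C(r(0)) (mod (yᵢ^p))`.** [folklore] -/
theorem expand_sub_C_mem_span_X_pow (p : ℕ) (r : MvPolynomial (Fin n) K) :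
    MvPolynomial.expand p r - MvPolynomial.C (MvPolynomial.constantCoeff r) ∈
      Ideal.span (Set.range fun i : Fin n => (MvPolynomial.X i : MvPolynomial (Fin n) K) ^ p) := by
  have h1 := Ideal.mem_map_of_mem (MvPolynomial.expand p (σ := Fin n) (R := K)).toRingHom
    (CoordinateSlicing.sub_C_constantCoeff_mem_span_X r)
  rw [Ideal.map_span, ← Set.range_comp, AlgHom.toRingHom_eq_coe, RingHom.coe_coe, map_sub, MvPolynomial.expand_C] at h1
  have h2 : ((MvPolynomial.expand p : MvPolynomial (Fin n) K →ₐ[K] MvPolynomial (Fin n) K) ∘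
      (MvPolynomial.X : Fin n → MvPolynomial (Fin n) K)) = fun i : Fin n => (MvPolynomial.X i : MvPolynomial (Fin n) K) ^ p := by
    funext i
    simp only [Function.comp_apply, MvPolynomial.expand_X]
  rwa [h2] at h1

/-! ## Shifts -/

/-- The shift `yᵢ ↦ yᵢ + bᵢ` followed by `yᵢ ↦ yᵢ − bᵢ` is the identity. [folklore] -/
theorem aeval_shift_shift (b : Fin n → K) (q : MvPolynomial (Fin n) K) :
    MvPolynomial.aeval (fun i : Fin n => (MvPolynomial.X i : MvPolynomial (Fin n) K) - MvPolynomial.C (b i))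
      (MvPolynomial.aeval (fun i : Fin n => (MvPolynomial.X i : MvPolynomial (Fin n) K) + MvPolynomial.C (b i)) q) = q := by
  rw [← AlgHom.comp_apply]
  conv_rhs => rw [← AlgHom.id_apply (R := K) q]
  congr 1
  refine MvPolynomial.algHom_ext fun i => ?_
  simp only [AlgHom.comp_apply, MvPolynomial.aeval_X, map_add, MvPolynomial.aeval_C, MvPolynomial.algebraMap_eq,
    AlgHom.id_apply, sub_add_cancel]

/-- **Shift past Frobenius twist**: `τ_b (ψ_p q) = ψ_p (τ_{b^p} q)` in characteristic `p`. [folklore] -/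
theorem aeval_shift_expand (p : ℕ) [Fact p.Prime] [CharP K p] (b : Fin n → K) (q : MvPolynomial (Fin n) K) :
    MvPolynomial.aeval (fun i : Fin n => (MvPolynomial.X i : MvPolynomial (Fin n) K) + MvPolynomial.C (b i))
      (MvPolynomial.expand p q) =
    MvPolynomial.expand p (MvPolynomial.aeval
      (fun i : Fin n => (MvPolynomial.X i : MvPolynomial (Fin n) K) + MvPolynomial.C (b i ^ p)) q) := by
  rw [← AlgHom.comp_apply, ← AlgHom.comp_apply]
  congr 1
  refine MvPolynomial.algHom_ext fun i => ?_
  rw [AlgHom.comp_apply, AlgHom.comp_apply, MvPolynomial.expand_X, map_pow, MvPolynomial.aeval_X, MvPolynomial.aeval_X,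
    map_add, MvPolynomial.expand_X, MvPolynomial.expand_C, add_pow_char, ← map_pow]

/-- `(τ_{b'} q)(0) = q(b')`: the constant coefficient after a shift is the value. [folklore] -/
theorem constantCoeff_aeval_shift (b' : Fin n → K) (q : MvPolynomial (Fin n) K) :
    MvPolynomial.constantCoeff (MvPolynomial.aeval
      (fun i : Fin n => (MvPolynomial.X i : MvPolynomial (Fin n) K) + MvPolynomial.C (b' i)) q) = MvPolynomial.eval b' q := by
  have h : (MvPolynomial.constantCoeff.comp (MvPolynomial.aeval (R := K)
      (fun i : Fin n => (MvPolynomial.X i : MvPolynomial (Fin n) K) + MvPolynomial.C (b' i))).toRingHom) =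
      (MvPolynomial.eval b') := by
    refine MvPolynomial.ringHom_ext (fun r => ?_) (fun i => ?_)
    · rw [RingHom.comp_apply, AlgHom.toRingHom_eq_coe, RingHom.coe_coe, MvPolynomial.aeval_C, MvPolynomial.algebraMap_eq,
        MvPolynomial.constantCoeff_C, MvPolynomial.eval_C]
    · rw [RingHom.comp_apply, AlgHom.toRingHom_eq_coe, RingHom.coe_coe, MvPolynomial.aeval_X, map_add,
        MvPolynomial.constantCoeff_X, MvPolynomial.constantCoeff_C, zero_add, MvPolynomial.eval_X]
  rw [← h]
  rfl

/-- `yᵢ`-degree of a shifted monomial `∏ⱼ (yⱼ + bⱼ)^(αⱼ)` is at most `αᵢ`. [folklore] -/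
theorem degreeOf_prod_shift_pow_le [Nontrivial K] (b : Fin n → K) (α : Fin n → ℕ) (i : Fin n) :
    MvPolynomial.degreeOf i (∏ j : Fin n, ((MvPolynomial.X j : MvPolynomial (Fin n) K) + MvPolynomial.C (b j)) ^ α j) ≤ α i := by
  classical
  refine (MvPolynomial.degreeOf_prod_le i _ _).trans ?_
  have h : ∀ j : Fin n, MvPolynomial.degreeOf i (((MvPolynomial.X j : MvPolynomial (Fin n) K) + MvPolynomial.C (b j)) ^ α j) ≤
      if j = i then α i else 0 := fun j => by
    refine (MvPolynomial.degreeOf_pow_le i _ _).trans ?_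
    have h1 := MvPolynomial.degreeOf_add_le i (MvPolynomial.X j : MvPolynomial (Fin n) K) (MvPolynomial.C (b j))
    rw [MvPolynomial.degreeOf_C, MvPolynomial.degreeOf_X] at h1
    split_ifs with hji
    · subst hji
      have h1' : MvPolynomial.degreeOf j ((MvPolynomial.X j : MvPolynomial (Fin n) K) + MvPolynomial.C (b j)) ≤ 1 := by
        simpa using h1
      calc α j * MvPolynomial.degreeOf j (MvPolynomial.X j + MvPolynomial.C (b j)) ≤ α j * 1 :=
            Nat.mul_le_mul_left _ h1'
        _ = α j := mul_one _
    · have hij : ¬ i = j := fun h => hji h.symm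
      have h2 : MvPolynomial.degreeOf i ((MvPolynomial.X j : MvPolynomial (Fin n) K) + MvPolynomial.C (b j)) = 0 := by
        have h1' : MvPolynomial.degreeOf i ((MvPolynomial.X j : MvPolynomial (Fin n) K) + MvPolynomial.C (b j)) ≤ 0 := by
          simpa [hij, hji] using h1
        exact Nat.le_zero.mp h1'
      rw [h2, mul_zero]
  calc ∑ j : Fin n, MvPolynomial.degreeOf i (((MvPolynomial.X j : MvPolynomial (Fin n) K) + MvPolynomial.C (b j)) ^ α j)
      ≤ ∑ j : Fin n, (if j = i then α i else 0) := Finset.sum_le_sum fun j _ => h j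
    _ = α i := by rw [Finset.sum_ite_eq' Finset.univ i, if_pos (Finset.mem_univ i)]

/-- **Coefficient extraction**: `Σ_α C(s_α) y^α = 0` over the reduced exponents forces every `s_α = 0`. [folklore] -/
theorem eq_zero_of_sum_C_mul_monomial_eq_zero (p : ℕ) (s : (Fin n → Fin p) → K)
    (h : ∑ α : Fin n → Fin p, MvPolynomial.C (s α) *
      MvPolynomial.monomial (Finsupp.equivFunOnFinite.symm fun j => ((α j : ℕ))) (1 : K) = 0) (α : Fin n → Fin p) :
    s α = 0 := by
  classical
  have hinj : Function.Injective fun α : Fin n → Fin p => (Finsupp.equivFunOnFinite.symm fun j => ((α j : ℕ)) : Fin n →₀ ℕ) := by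
    intro α β hαβ
    funext j
    have h1 := congrArg (fun f : Fin n →₀ ℕ => f j) hαβ
    simp only [Finsupp.coe_equivFunOnFinite_symm] at h1
    exact Fin.ext h1
  have hc := congrArg (MvPolynomial.coeff (Finsupp.equivFunOnFinite.symm fun j => ((α j : ℕ)))) h
  rw [MvPolynomial.coeff_zero, MvPolynomial.coeff_sum] at hc
  simp only [MvPolynomial.C_mul_monomial, mul_one, MvPolynomial.coeff_monomial] at hc
  rw [Finset.sum_eq_single α (fun β _ hβ => if_neg fun h' => hβ (hinj h')) (fun h' => absurd (Finset.mem_univ α) h')]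
    at hc
  rwa [if_pos rfl] at hc

/-! ## Evaluating the certificate -/

/-- **The Bézout identity forces a non-vanishing `p`-coefficient at every torus zero of `F`.** [folklore] -/
theorem exists_aeval_expand_ne_zero {k : Type} [Field k] (p : ℕ) {L : Type} [Field L] [Algebra k L]
    (F : MvPolynomial (Fin n) k) (c : (Fin n → Fin p) → MvPolynomial (Fin n) k)
    (hcert : (1 : MvPolynomial (Option (Fin n)) k) ∈ Ideal.span
      ({MvPolynomial.rename some F,
          1 - MvPolynomial.X none * ∏ j : Fin n, (MvPolynomial.X (some j) : MvPolynomial (Option (Fin n)) k)} ∪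
        Set.range fun α : Fin n → Fin p => MvPolynomial.rename some (MvPolynomial.expand p (c α))))
    (b : Fin n → L) (hb : ∀ i, b i ≠ 0) (hFb : MvPolynomial.aeval b F = 0) :
    ∃ α : Fin n → Fin p, MvPolynomial.aeval b (MvPolynomial.expand p (c α)) ≠ 0 := by
  by_contra hall
  push Not at hall
  have hprod : (∏ j : Fin n, b j) ≠ 0 := Finset.prod_ne_zero_iff.mpr fun j _ => hb j
  -- evaluate at `(b, (∏ b)⁻¹)`
  have hle : Ideal.span
      ({MvPolynomial.rename some F,
          1 - MvPolynomial.X none * ∏ j : Fin n, (MvPolynomial.X (some j) : MvPolynomial (Option (Fin n)) k)} ∪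
        Set.range fun α : Fin n → Fin p => MvPolynomial.rename some (MvPolynomial.expand p (c α))) ≤
      RingHom.ker (MvPolynomial.aeval (R := k) (fun o : Option (Fin n) => o.elim (∏ j : Fin n, b j)⁻¹ b)).toRingHom := by
    rw [Ideal.span_le]
    rintro x (hx | ⟨α, rfl⟩)
    · rcases hx with rfl | rfl
      · rw [SetLike.mem_coe, RingHom.mem_ker, AlgHom.toRingHom_eq_coe, RingHom.coe_coe, MvPolynomial.aeval_rename]
        exact hFb
      · rw [SetLike.mem_coe, RingHom.mem_ker, AlgHom.toRingHom_eq_coe, RingHom.coe_coe, map_sub, map_one, map_mul,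
          MvPolynomial.aeval_X, Option.elim_none, map_prod]
        simp only [MvPolynomial.aeval_X, Option.elim_some]
        rw [inv_mul_cancel₀ hprod, sub_self]
    · rw [SetLike.mem_coe, RingHom.mem_ker, AlgHom.toRingHom_eq_coe, RingHom.coe_coe, MvPolynomial.aeval_rename]
      exact hall α
  have h1 := hle hcert
  rw [RingHom.mem_ker, map_one] at h1
  exact one_ne_zero h1

/-! ## (C5) -/

/-- **(C5) TORUS FEDDER CERTIFICATE ⇒ F-PURE FACE** (`CNEngineSig.stub_faceFPure_of_certificate`, verbatim). For a face polynomial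
`F`, write `F^(p-1) = Σ_α ψ_p(c_α) · y^α` over the reduced exponents `α ∈ [0,p)^n` (`ψ_p = expand p`). One Bézout identity
`1 ∈ (F, ψ_p(c_α) (all α), 1 - t · ∏ⱼ yⱼ)` in `k[y, t]` (`t = X none`, `yⱼ = X (some j)`) certifies Fedder's test for `F ⊗ K`
at every torus point `b` of every field `K ⊇ k` with `F(b) = 0`. [folklore] -/
theorem faceFPure_of_certificate : ∀ (p : ℕ) [Fact p.Prime] (k : Type) [Field k] [CharP k p] (n : ℕ)
    (F : MvPolynomial (Fin n) k) (c : (Fin n → Fin p) → MvPolynomial (Fin n) k),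
    F ^ (p - 1) = ∑ α : Fin n → Fin p, MvPolynomial.expand p (c α) *
      MvPolynomial.monomial (Finsupp.equivFunOnFinite.symm fun j => ((α j : ℕ))) 1 →
    (1 : MvPolynomial (Option (Fin n)) k) ∈ Ideal.span
      ({MvPolynomial.rename some F,
          1 - MvPolynomial.X none * ∏ j : Fin n, (MvPolynomial.X (some j) : MvPolynomial (Option (Fin n)) k)} ∪
        Set.range fun α : Fin n → Fin p => MvPolynomial.rename some (MvPolynomial.expand p (c α))) →
    ∀ (K : Type) [Field K] [Algebra k K] (b : Fin n → K), (∀ i, b i ≠ 0) →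
      MvPolynomial.aeval b F = 0 →
      (MvPolynomial.map (algebraMap k K) F) ^ (p - 1) ∉
        Ideal.span (Set.range fun i : Fin n => (MvPolynomial.X i - MvPolynomial.C (b i)) ^ p) := by
  intro p _ k _ _ n F c hF hcert K _ _ b hb hFb hmem
  classical
  have hp : 0 < p := (Fact.out : p.Prime).pos
  haveI : CharP K p := charP_of_injective_algebraMap (algebraMap k K).injective p
  haveI : CharP (MvPolynomial (Fin n) K) p := charP_of_injective_algebraMap (MvPolynomial.C_injective (Fin n) K) p
  -- (1) some `c_α(b^p) ≠ 0`
  obtain ⟨α₀, hα₀⟩ := exists_aeval_expand_ne_zero p F c hcert b hb hFb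
  -- (2) the split form of `(F ⊗ K)^(p-1)`
  have hG : (MvPolynomial.map (algebraMap k K) F) ^ (p - 1) = ∑ α : Fin n → Fin p,
      MvPolynomial.expand p (MvPolynomial.map (algebraMap k K) (c α)) *
        MvPolynomial.monomial (Finsupp.equivFunOnFinite.symm fun j => ((α j : ℕ))) (1 : K) := by
    rw [← map_pow, hF, map_sum]
    refine Finset.sum_congr rfl fun α _ => ?_
    rw [map_mul, MvPolynomial.map_expand, MvPolynomial.map_monomial, map_one]
  -- shift `τ : yᵢ ↦ yᵢ + bᵢ`: `τ (F ⊗ K)^(p-1) ∈ (yᵢ^p)`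
  have hτJ : MvPolynomial.aeval (fun i : Fin n => (MvPolynomial.X i : MvPolynomial (Fin n) K) + MvPolynomial.C (b i))
      ((MvPolynomial.map (algebraMap k K) F) ^ (p - 1)) ∈
      Ideal.span (Set.range fun i : Fin n => (MvPolynomial.X i : MvPolynomial (Fin n) K) ^ p) := by
    have h1 := Ideal.mem_map_of_mem (MvPolynomial.aeval (R := K)
      (fun i : Fin n => (MvPolynomial.X i : MvPolynomial (Fin n) K) + MvPolynomial.C (b i))).toRingHom hmem
    rw [Ideal.map_span, ← Set.range_comp] at h1
    have h2 : ((MvPolynomial.aeval (R := K)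
        (fun i : Fin n => (MvPolynomial.X i : MvPolynomial (Fin n) K) + MvPolynomial.C (b i))).toRingHom ∘
        fun i : Fin n => ((MvPolynomial.X i : MvPolynomial (Fin n) K) - MvPolynomial.C (b i)) ^ p) =
        fun i : Fin n => (MvPolynomial.X i : MvPolynomial (Fin n) K) ^ p := by
      funext i
      simp only [Function.comp_apply, AlgHom.toRingHom_eq_coe, RingHom.coe_coe, map_pow, map_sub, MvPolynomial.aeval_X,
        MvPolynomial.aeval_C, MvPolynomial.algebraMap_eq, add_sub_cancel_right]
    rw [h2] at h1
    exact h1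
  -- the scalars `s_α = c_α(b^p)`
  set s : (Fin n → Fin p) → K := fun α => MvPolynomial.constantCoeff (MvPolynomial.aeval
    (fun i : Fin n => (MvPolynomial.X i : MvPolynomial (Fin n) K) + MvPolynomial.C (b i ^ p))
      (MvPolynomial.map (algebraMap k K) (c α))) with hs_def
  -- `P := Σ_α C(s_α) ∏ (yⱼ + bⱼ)^(αⱼ)` lies in `(yᵢ^p)`
  have hP : ∑ α : Fin n → Fin p, MvPolynomial.C (s α) *
      ∏ j : Fin n, ((MvPolynomial.X j : MvPolynomial (Fin n) K) + MvPolynomial.C (b j)) ^ ((α j : ℕ)) ∈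
      Ideal.span (Set.range fun i : Fin n => (MvPolynomial.X i : MvPolynomial (Fin n) K) ^ p) := by
    rw [hG, map_sum] at hτJ
    have hdiff : ∑ α : Fin n → Fin p, (MvPolynomial.aeval
        (fun i : Fin n => (MvPolynomial.X i : MvPolynomial (Fin n) K) + MvPolynomial.C (b i))
        (MvPolynomial.expand p (MvPolynomial.map (algebraMap k K) (c α)) *
          MvPolynomial.monomial (Finsupp.equivFunOnFinite.symm fun j => ((α j : ℕ))) (1 : K)) -
        MvPolynomial.C (s α) * ∏ j : Fin n, ((MvPolynomial.X j : MvPolynomial (Fin n) K) + MvPolynomial.C (b j)) ^ ((α j : ℕ))) ∈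
        Ideal.span (Set.range fun i : Fin n => (MvPolynomial.X i : MvPolynomial (Fin n) K) ^ p) := by
      refine Ideal.sum_mem _ fun α _ => ?_
      have hmon : MvPolynomial.aeval (fun i : Fin n => (MvPolynomial.X i : MvPolynomial (Fin n) K) + MvPolynomial.C (b i))
          (MvPolynomial.monomial (Finsupp.equivFunOnFinite.symm fun j => ((α j : ℕ))) (1 : K)) =
          ∏ j : Fin n, ((MvPolynomial.X j : MvPolynomial (Fin n) K) + MvPolynomial.C (b j)) ^ ((α j : ℕ)) := by
        rw [MvPolynomial.aeval_monomial, map_one, one_mul, Finsupp.prod_fintype _ _ fun i => pow_zero _]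
        simp only [Finsupp.coe_equivFunOnFinite_symm]
      rw [map_mul, hmon, aeval_shift_expand, ← sub_mul]
      refine Ideal.mul_mem_right _ _ ?_
      have h3 := expand_sub_C_mem_span_X_pow p (MvPolynomial.aeval
        (fun i : Fin n => (MvPolynomial.X i : MvPolynomial (Fin n) K) + MvPolynomial.C (b i ^ p))
          (MvPolynomial.map (algebraMap k K) (c α)))
      exact h3
    have h4 := Ideal.sub_mem _ hτJ hdiff
    rwa [← Finset.sum_sub_distrib, Finset.sum_congr rfl fun α _ => sub_sub_cancel _ _] at h4
  -- all `yᵢ`-degrees of `P` are `< p`, so `P = 0`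
  have hP0 : ∑ α : Fin n → Fin p, MvPolynomial.C (s α) *
      ∏ j : Fin n, ((MvPolynomial.X j : MvPolynomial (Fin n) K) + MvPolynomial.C (b j)) ^ ((α j : ℕ)) = 0 := by
    refine eq_zero_of_mem_of_degreeOf_lt p hp hP fun i => ?_
    refine lt_of_le_of_lt (MvPolynomial.degreeOf_sum_le i _ _) ?_
    refine (Finset.sup_lt_iff hp).mpr fun α _ => ?_
    refine lt_of_le_of_lt (MvPolynomial.degreeOf_mul_le i _ _) ?_
    rw [MvPolynomial.degreeOf_C, zero_add]
    exact lt_of_le_of_lt (degreeOf_prod_shift_pow_le b (fun j => ((α j : ℕ))) i) (α i).is_lt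
  -- shift back: `Σ_α C(s_α) y^α = 0`, so every `s_α = 0`
  have hH : ∑ α : Fin n → Fin p, MvPolynomial.C (s α) *
      MvPolynomial.monomial (Finsupp.equivFunOnFinite.symm fun j => ((α j : ℕ))) (1 : K) = 0 := by
    have h5 := congrArg (MvPolynomial.aeval
      (fun i : Fin n => (MvPolynomial.X i : MvPolynomial (Fin n) K) - MvPolynomial.C (b i))) hP0
    rw [map_zero, map_sum] at h5
    rw [← h5]
    refine Finset.sum_congr rfl fun α _ => ?_
    rw [map_mul, MvPolynomial.aeval_C, MvPolynomial.algebraMap_eq, map_prod]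
    congr 1
    rw [MvPolynomial.monomial_eq, MvPolynomial.C_1, one_mul, Finsupp.prod_fintype _ _ fun i => pow_zero _]
    refine Finset.prod_congr rfl fun j _ => ?_
    rw [map_pow, map_add, MvPolynomial.aeval_X, MvPolynomial.aeval_C, MvPolynomial.algebraMap_eq, sub_add_cancel]
    simp only [Finsupp.coe_equivFunOnFinite_symm]
  have hs0 := eq_zero_of_sum_C_mul_monomial_eq_zero p s hH α₀
  -- but `s_{α₀} = c_{α₀}(b^p) = ψ_p(c_{α₀})(b) ≠ 0`
  apply hα₀
  rw [MvPolynomial.aeval_expand]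
  rw [hs_def] at hs0
  simp only at hs0
  rw [constantCoeff_aeval_shift, MvPolynomial.eval_map] at hs0
  rw [← hs0]
  rfl

end Summit.ResolutionOfSingularities.ResolutionOfSingularities.Theorems.FInjectiveMacaulayfication.FaceFPureOfCertificate

end
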